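import Summits.BirchSwinnertonDyer.Rank1Residual.GaloisImage.PropagatedConditionCount
import Summits.BirchSwinnertonDyer.Rank1Residual.GaloisImage.LocalEulerPoincareCharacteristicHolds
import Literature.NumberTheory.EllipticCurves.ArchimedeanKummerImageMaximal
import Literature.NumberTheory.EllipticCurves.SubgroupSelmerProofs
import HarnessLib

/-!
# Local bounds for `H¹(K_Σ/K, E[p^∞])`: the `p^k`-torsion of `𝒫_E(K_v) = H¹(K_v, E(K̄_v))` has order
# `≤ B_v · #(𝓞_v/p^k)` at a finite place and is uniformly bounded at an infinite place — in the currency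
# `discreteH1 (localSubgroup ⊤ K_v) (localPoints W K_v)` of `Greenberg1999.casselsSurjectivity_H1Sigma` /
# `h1Sigma_zpCorank_le_degree`

Crux K4 `SignedControlAtTwo` (stmt-BirchSwinnertonDyer-20309; routes `ThetaPartnerAtTwo` / `ResidualThetaTransportAtTwo`),
line `eulerchar` v7 (stub `stub_pubGreenbergTwo` = PUB×4); width seat `prover-bsd-wall-tp2-p3-w3` g4. Part (L) of the
attempt on the PUB antecedent `Greenberg1999.h1Sigma_zpCorank_le_degree ℚ` (Greenberg, LNM 1716, pp. 119–120: «The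
`ℤ_p`-corank of `𝒫_E^Σ(F)` is equal to `[F:ℚ]`», the local count behind `corank_{ℤ_p} H¹(F_Σ/F, E[p^∞]) ≤ [F:ℚ]`).

Everything local is ALREADY a theorem of the tree; this file only re-spells it in the currency of the Greenberg facts
(`discreteH1 (localSubgroup ⊤ K_v) (localPoints W K_v)`, the target of `W.localResOver p ⊤ K_v`), along the bijective
restriction `H¹(Γ_{K_v}, ·) → H¹((Γ_{K_v} → Γ_K)⁻¹(⊤), ·)` (`bijective_resH1Hom_subgroupIncl`):
* §1 transport of `n`-torsion counts along an additive isomorphism / the bijective restriction;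
* §2 finite places: `#𝒫_E(K_v)[p^k] ≤ B_v · #(𝓞_v/p^k)` with `B_v = [E(K_v) : U]` (tree: the ORDER FORM of Tate local
  duality `#H¹(K_v, E)[p^k] = #E(K_v)[p^k] · #(𝓞_v/p^k)`, `natCard_torsionBy_galoisCohomology_localGaloisModule_eq_of_localEuler`,
  fed with the PROVED local Euler–Poincaré characteristic `localEulerPoincareCharacteristic_holds`, and the uniform
  torsion bound `exists_natCard_ker_nsmul_adicCompletion_le`); `#(𝓞_v/p^k) = 1` off `p`, `= p^k` at the place of `ℚ`
  above `p`;
* §3 infinite places: `H¹(K_w, E(K̄_w))` is FINITE (killed by `2`, and `#H¹(K_w,E)[2] ≤ #H¹(K_w, E[2]) < ∞` by the local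
  Kummer sequence), hence its `p^k`-torsion is uniformly bounded.

THEOREMS ONLY (no definition, no named fact, no `sorry`); nothing about any curve is asserted; BSD is not proved by
any of this.

References: [GreenbergLNM1716] §2 pp. 71, 74, 78; §4 pp. 104–106, 119–120; [MilneADT2006] I Thm. 2.8, Lemma 3.3,
Cor. 3.4, Rem. 3.7; [SilvermanAEC2009] VII.6.3, X.§4.
-/

set_option autoImplicit false
-- the Theorems namespace of this sub repeats the summit name by design (D-0017 nested layout)
set_option linter.dupNamespace false

noncomputable section

open scoped Classical NumberField AddSubgroup

universe u

namespace Summit.BirchSwinnertonDyer.BirchSwinnertonDyer.Theorems.SignedEC.H1SigmaCorank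

open NumberField IsDedekindDomain Field WeierstrassCurve
open Literature.NumberTheory.EllipticCurves Literature.NumberTheory.GaloisRepresentations
open Summit.BirchSwinnertonDyer.Rank1Residual.GaloisImage

/-! ## §1 Transport of torsion counts -/

section Transport

variable {A B : Type*} [AddCommGroup A] [AddCommGroup B]

/-- An additive isomorphism restricts to the `n`-torsion subgroups (any `n : ℤ`). [folklore] -/
theorem natCard_torsionBy_congr (e : A ≃+ B) (n : ℤ) : Nat.card (A[n]) = Nat.card (B[n]) := by
  refine Nat.card_congr (Equiv.ofBijective (fun x : A[n] ↦ (⟨e x, ?_⟩ : B[n])) ⟨?_, ?_⟩)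
  · have hx : n • (x : A) = 0 := x.2
    show n • e x = 0
    rw [← map_zsmul, hx, map_zero]
  · intro x y hxy
    exact Subtype.ext (e.injective (congrArg (fun z : B[n] ↦ (z : B)) hxy))
  · intro y
    have hy : n • (y : B) = 0 := y.2
    refine ⟨⟨e.symm y, ?_⟩, Subtype.ext (e.apply_symm_apply y)⟩
    show n • e.symm y = 0
    rw [← map_zsmul, hy, map_zero]

/-- Along an INJECTIVE additive map the `n`-torsion counts do not increase, when the target's `n`-torsion is finite.
[folklore] -/
theorem natCard_torsionBy_le_of_injective (f : A →+ B) (hf : Function.Injective f) (n : ℤ) [Finite (B[n])] :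
    Nat.card (A[n]) ≤ Nat.card (B[n]) := by
  refine Nat.card_le_card_of_injective (fun x : A[n] ↦ (⟨f x, ?_⟩ : B[n])) ?_
  · have hx : n • (x : A) = 0 := x.2
    show n • f x = 0
    rw [← map_zsmul, hx, map_zero]
  · intro x y hxy
    exact Subtype.ext (hf (congrArg (fun z : B[n] ↦ (z : B)) hxy))

/-- Finiteness of `n`-torsion passes along an injective additive map. [folklore] -/
theorem finite_torsionBy_of_injective (f : A →+ B) (hf : Function.Injective f) (n : ℤ) [Finite (B[n])] :
    Finite (A[n]) := by
  refine Finite.of_injective (fun x : A[n] ↦ (⟨f x, ?_⟩ : B[n])) ?_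
  · have hx : n • (x : A) = 0 := x.2
    show n • f x = 0
    rw [← map_zsmul, hx, map_zero]
  · intro x y hxy
    exact Subtype.ext (hf (congrArg (fun z : B[n] ↦ (z : B)) hxy))

end Transport

section LocalCurrency

variable {K : Type u} [Field K] (W : WeierstrassCurve K) (E : Type u) [Field E] [Algebra K E]

/-- **The currency of the Greenberg facts is `H¹(Γ_E, E(K̄_E))` up to a canonical isomorphism**: restriction along
`(Γ_E → Γ_K)⁻¹(⊤) ↪ Γ_E` is an additive isomorphism
`H¹(Γ_E, E(K̄_E)) = galoisCohomology (W.localGaloisModule E) 1 ≃+ discreteH1 (localSubgroup ⊤ E) (localPoints W E)`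
(tree `bijective_resH1Hom_subgroupIncl` with `mem_localSubgroup_top`). [cite: GreenbergLNM1716, §2 (the groups `G_{M_η}`)] -/
theorem exists_addEquiv_localH1_localSubgroup_top :
    ∃ e : galoisCohomology (W.localGaloisModule E) 1 ≃+
        discreteH1 (localSubgroup (⊤ : Subgroup (absoluteGaloisGroup K)) E) (localPoints W E),
      ∀ c, e c = resH1Hom (Literature.NumberTheory.EllipticCurves.subgroupIncl (localSubgroup (⊤ : Subgroup (absoluteGaloisGroup K)) E))
        (AddMonoidHom.id (localPoints W E)) (fun _ _ ↦ rfl) c :=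
  ⟨AddEquiv.ofBijective
    (resH1Hom (Literature.NumberTheory.EllipticCurves.subgroupIncl (localSubgroup (⊤ : Subgroup (absoluteGaloisGroup K)) E))
      (AddMonoidHom.id (localPoints W E)) (fun _ _ ↦ rfl))
    (bijective_resH1Hom_subgroupIncl _ _ mem_localSubgroup_top), fun _ ↦ rfl⟩

/-- Transport of the `n`-torsion count to the currency of the Greenberg facts. [folklore] -/
theorem natCard_torsionBy_localSubgroup_top_eq (n : ℤ) :
    Nat.card ((discreteH1 (localSubgroup (⊤ : Subgroup (absoluteGaloisGroup K)) E) (localPoints W E))[n]) =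
      Nat.card ((galoisCohomology (W.localGaloisModule E) 1)[n]) := by
  obtain ⟨e, -⟩ := exists_addEquiv_localH1_localSubgroup_top W E
  exact (natCard_torsionBy_congr e n).symm

/-- Transport of the finiteness of the `n`-torsion. [folklore] -/
theorem finite_torsionBy_localSubgroup_top_of (n : ℤ) [Finite ((galoisCohomology (W.localGaloisModule E) 1)[n])] :
    Finite ((discreteH1 (localSubgroup (⊤ : Subgroup (absoluteGaloisGroup K)) E) (localPoints W E))[n]) := by
  obtain ⟨e, -⟩ := exists_addEquiv_localH1_localSubgroup_top W E
  exact finite_torsionBy_of_injective e.symm.toAddMonoidHom (fun x y h ↦ e.symm.injective h) n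

end LocalCurrency

/-! ## §2 Finite places: `#𝒫_E(K_v)[p^k] ≤ B_v · #(𝓞_v/p^k)` -/

section Finite

variable {K : Type u} [Field K] [NumberField K] (W : WeierstrassCurve K) [W.IsElliptic]
  (v : HeightOneSpectrum (𝓞 K)) (p : ℕ) [hp : Fact p.Prime]

/-- **`#H¹(K_v, E)[p^k] ≤ B_v · #(𝓞_v/p^k)` for every `k`, with ONE `B_v > 0`, and each `H¹(K_v, E)[p^k]` finite** —
at ANY finite place `v` of a number field. For `k ≥ 1` this is the ORDER FORM of Tate local duality
`#H¹(K_v, E)[p^k] = #E(K_v)[p^k] · #(𝓞_v/p^k)` (tree, from the proved local Euler–Poincaré characteristic) with the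
uniform bound `#E(K_v)[n] ≤ B_v = [E(K_v) : U]` (tree); `k = 0` is the trivial group.
[cite: MilneADT2006, I Thm. 2.8, Thm. 3.2, Lemma 3.3, Cor. 3.4] [cite: GreenbergLNM1716, §2 p. 74, §4 p. 119] -/
theorem exists_natCard_torsionBy_localH1_le :
    ∃ B : ℕ, 0 < B ∧ ∀ k : ℕ,
      Finite ((galoisCohomology (W.localGaloisModule (v.adicCompletion K)) 1)[((p ^ k : ℕ) : ℤ)]) ∧
      Nat.card ((galoisCohomology (W.localGaloisModule (v.adicCompletion K)) 1)[((p ^ k : ℕ) : ℤ)]) ≤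
        B * Nat.card (v.adicCompletionIntegers K ⧸
          Ideal.span {((p ^ k : ℕ) : v.adicCompletionIntegers K)}) := by
  haveI : CharZero (v.adicCompletion K) := charZero_of_injective_algebraMap (algebraMap K _).injective
  have hEP : localEulerPoincareCharacteristic (v.adicCompletion K) :=
    localEulerPoincareCharacteristic_holds (v.adicCompletion K)
  obtain ⟨B, hB, hle⟩ := exists_natCard_ker_nsmul_adicCompletion_le W v
  refine ⟨B, hB, fun k ↦ ?_⟩
  rcases k with _ | k
  · -- `k = 0`: the trivial group
    haveI : Subsingleton ((galoisCohomology (W.localGaloisModule (v.adicCompletion K)) 1)[((p ^ 0 : ℕ) : ℤ)]) :=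
      ⟨fun x y ↦ Subtype.ext (by
        have hx : p ^ 0 • (x : galoisCohomology (W.localGaloisModule (v.adicCompletion K)) 1) = 0 :=
          AddSubgroup.torsionBy.nsmul_iff.mp x.2
        have hy : p ^ 0 • (y : galoisCohomology (W.localGaloisModule (v.adicCompletion K)) 1) = 0 :=
          AddSubgroup.torsionBy.nsmul_iff.mp y.2
        simp only [pow_zero, one_smul] at hx hy
        rw [hx, hy])⟩
    refine ⟨inferInstance, ?_⟩
    have h1 : Nat.card (v.adicCompletionIntegers K ⧸
        Ideal.span {((p ^ 0 : ℕ) : v.adicCompletionIntegers K)}) = 1 := by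
      rw [pow_zero, Nat.cast_one, Ideal.span_singleton_one]
      haveI : Subsingleton (v.adicCompletionIntegers K ⧸ (⊤ : Ideal (v.adicCompletionIntegers K))) :=
        Ideal.Quotient.subsingleton_iff.mpr rfl
      exact Nat.card_of_subsingleton 0
    rw [h1, mul_one, Nat.card_of_subsingleton (0 : (galoisCohomology (W.localGaloisModule
      (v.adicCompletion K)) 1)[((p ^ 0 : ℕ) : ℤ)])]
    exact hB
  · haveI : NeZero (p ^ (k + 1)) := ⟨pow_ne_zero _ hp.out.ne_zero⟩
    have hcard := natCard_torsionBy_galoisCohomology_localGaloisModule_eq_of_localEuler W v (p ^ (k + 1))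
      (hp.out.isPrimePow.pow (Nat.succ_ne_zero k)) hEP
    haveI := W.finite_ker_nsmul_adicCompletion v (pow_ne_zero (k + 1) hp.out.ne_zero)
    have hfin : Finite ((galoisCohomology (W.localGaloisModule (v.adicCompletion K)) 1)[((p ^ (k + 1) : ℕ) : ℤ)]) := by
      refine Nat.finite_of_card_ne_zero ?_
      rw [hcard]
      exact mul_ne_zero Nat.card_pos.ne' (LocalPoints.card_quotient_span_natCast_ne_zero v (NeZero.ne _))
    refine ⟨hfin, ?_⟩
    rw [hcard]
    exact Nat.mul_le_mul_right _ (hle _ (NeZero.ne _))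

/-- The same bound and finiteness in the currency `discreteH1 (localSubgroup ⊤ K_v) (localPoints W K_v)` of the Greenberg
facts (transport along the bijective restriction of §1). [cite: MilneADT2006, I Cor. 3.4 and Lemma 3.3] -/
theorem exists_natCard_torsionBy_localSubgroup_top_le :
    ∃ B : ℕ, 0 < B ∧ ∀ k : ℕ,
      Finite ((discreteH1 (localSubgroup (⊤ : Subgroup (absoluteGaloisGroup K)) (v.adicCompletion K))
        (localPoints W (v.adicCompletion K)))[((p ^ k : ℕ) : ℤ)]) ∧
      Nat.card ((discreteH1 (localSubgroup (⊤ : Subgroup (absoluteGaloisGroup K)) (v.adicCompletion K))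
        (localPoints W (v.adicCompletion K)))[((p ^ k : ℕ) : ℤ)]) ≤
        B * Nat.card (v.adicCompletionIntegers K ⧸
          Ideal.span {((p ^ k : ℕ) : v.adicCompletionIntegers K)}) := by
  obtain ⟨B, hB, h⟩ := exists_natCard_torsionBy_localH1_le W v p
  refine ⟨B, hB, fun k ↦ ?_⟩
  obtain ⟨hfin, hle⟩ := h k
  haveI := hfin
  exact ⟨finite_torsionBy_localSubgroup_top_of W (v.adicCompletion K) _,
    (natCard_torsionBy_localSubgroup_top_eq W (v.adicCompletion K) _).le.trans hle⟩

omit [W.IsElliptic] hp in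
/-- `#(𝓞_v/p^k) = 1` for `v ∤ p` (tree `natCard_quot_adicCompletionIntegers_eq_one_of_not_mem`). [folklore] -/
theorem natCard_quot_adicCompletionIntegers_pow_eq_one_of_not_mem (hpv : ((p : ℕ) : 𝓞 K) ∉ v.asIdeal) (k : ℕ) :
    Nat.card (v.adicCompletionIntegers K ⧸ Ideal.span {((p ^ k : ℕ) : v.adicCompletionIntegers K)}) = 1 := by
  refine natCard_quot_adicCompletionIntegers_eq_one_of_not_mem v ?_
  rw [Nat.cast_pow]
  rcases k with _ | k
  · rw [pow_zero]
    exact fun h ↦ v.isPrime.ne_top ((Ideal.eq_top_iff_one _).mpr h)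
  · exact fun h ↦ hpv (v.isPrime.mem_of_pow_mem (k + 1) h)

omit hp in
/-- **Off `p`: `#𝒫_E(K_v)[p^k] ≤ B_v` uniformly in `k`** (`v ∤ p` finite; `#(𝓞_v/p^k) = 1`), with finiteness, in the
currency of the Greenberg facts. (`𝒫_E(K_v)` is then FINITE, Greenberg p. 74: «if `v ∤ p`, `H¹(F_v, E[p^∞])` is finite».)
[cite: GreenbergLNM1716, §2 p. 74] [cite: MilneADT2006, I Cor. 3.4] -/
theorem exists_natCard_torsionBy_localSubgroup_top_le_of_not_mem [Fact p.Prime] (hpv : ((p : ℕ) : 𝓞 K) ∉ v.asIdeal) :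
    ∃ B : ℕ, 0 < B ∧ ∀ k : ℕ,
      Finite ((discreteH1 (localSubgroup (⊤ : Subgroup (absoluteGaloisGroup K)) (v.adicCompletion K))
        (localPoints W (v.adicCompletion K)))[((p ^ k : ℕ) : ℤ)]) ∧
      Nat.card ((discreteH1 (localSubgroup (⊤ : Subgroup (absoluteGaloisGroup K)) (v.adicCompletion K))
        (localPoints W (v.adicCompletion K)))[((p ^ k : ℕ) : ℤ)]) ≤ B := by
  obtain ⟨B, hB, h⟩ := exists_natCard_torsionBy_localSubgroup_top_le W v p
  refine ⟨B, hB, fun k ↦ ⟨(h k).1, ?_⟩⟩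
  have := (h k).2
  rwa [natCard_quot_adicCompletionIntegers_pow_eq_one_of_not_mem v p hpv k, mul_one] at this

end Finite

section Rat

variable (W : WeierstrassCurve ℚ) [W.IsElliptic] (v : HeightOneSpectrum (𝓞 ℚ)) (p : ℕ) [hp : Fact p.Prime]

omit [W.IsElliptic] in
/-- `#(ℤ_v / p^k ℤ_v) = p^k` at the place `v ∋ p` of `ℚ` (tree: `#(ℤ_v/p) = p`, and `#(R/(ab)) = #(R/(a))·#(R/(b))`).
[folklore] -/
theorem natCard_quot_adicCompletionIntegers_prime_pow_of_mem (hpv : ((p : ℕ) : 𝓞 ℚ) ∈ v.asIdeal) (k : ℕ) :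
    Nat.card (v.adicCompletionIntegers ℚ ⧸ Ideal.span {((p ^ k : ℕ) : v.adicCompletionIntegers ℚ)}) = p ^ k := by
  induction k with
  | zero =>
    rw [pow_zero, Nat.cast_one, Ideal.span_singleton_one]
    haveI : Subsingleton (v.adicCompletionIntegers ℚ ⧸ (⊤ : Ideal (v.adicCompletionIntegers ℚ))) :=
      Ideal.Quotient.subsingleton_iff.mpr rfl
    exact Nat.card_of_subsingleton 0
  | succ k ih =>
    rw [pow_succ, Nat.cast_mul, natCard_quotient_span_singleton_mul'
      (LocalPoints.natCast_ne_zero v (pow_ne_zero k hp.out.ne_zero)), ih,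
      natCard_quot_adicCompletionIntegers_of_prime_mem p hpv]

/-- **At the place of `ℚ` above `p`: `#𝒫_E(ℚ_p)[p^k] ≤ B · p^k`** for every `k`, with finiteness, in the currency of
the Greenberg facts — the local count «`corank_{ℤ_p} H¹(F_v, E[p^∞])/Im κ_v = [F_v:ℚ_p]`» (Greenberg p. 78, here
`[ℚ_p:ℚ_p] = 1`) in its inequality form. [cite: GreenbergLNM1716, §2 p. 78, §4 pp. 119–120] [cite: MilneADT2006, I Cor. 3.4] -/
theorem exists_natCard_torsionBy_localSubgroup_top_le_of_mem (hpv : ((p : ℕ) : 𝓞 ℚ) ∈ v.asIdeal) :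
    ∃ B : ℕ, 0 < B ∧ ∀ k : ℕ,
      Finite ((discreteH1 (localSubgroup (⊤ : Subgroup (absoluteGaloisGroup ℚ)) (v.adicCompletion ℚ))
        (localPoints W (v.adicCompletion ℚ)))[((p ^ k : ℕ) : ℤ)]) ∧
      Nat.card ((discreteH1 (localSubgroup (⊤ : Subgroup (absoluteGaloisGroup ℚ)) (v.adicCompletion ℚ))
        (localPoints W (v.adicCompletion ℚ)))[((p ^ k : ℕ) : ℤ)]) ≤ B * p ^ k := by
  obtain ⟨B, hB, h⟩ := exists_natCard_torsionBy_localSubgroup_top_le W v p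
  refine ⟨B, hB, fun k ↦ ⟨(h k).1, ?_⟩⟩
  have := (h k).2
  rwa [natCard_quot_adicCompletionIntegers_prime_pow_of_mem v p hpv k] at this

end Rat

/-! ## §3 Infinite places: `H¹(K_w, E(K̄_w))` is finite -/

section Infinite

variable {K : Type u} [Field K] [NumberField K] (W : WeierstrassCurve K) [W.IsElliptic] (w : InfinitePlace K)

/-- **`H¹(K_w, E(K̄_w))` is FINITE at an infinite place `w`**: it is killed by `2` (`Γ_{K_w}` has order `≤ 2`, tree
`torsionBy_galoisCohomology_localGaloisModule_eq_top_infinitePlace`), and `#H¹(K_w, E)[2] · #𝓛_w = #H¹(K_w, E[2])` (local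
Kummer sequence, tree) with `H¹(K_w, E[2])` finite. (Its order is `≤ 2`, Greenberg p. 106; only finiteness is recorded.)
[cite: GreenbergLNM1716, §4 pp. 105–106] [cite: MilneADT2006, I Rem. 3.7] -/
theorem finite_localH1_infinitePlace : Finite (galoisCohomology (W.localGaloisModule w.Completion) 1) := by
  haveI := finite_absoluteGaloisGroup_completion_infinitePlace w
  haveI : CharZero w.Completion := charZero_of_injective_algebraMap (algebraMap K w.Completion).injective
  have h2 : (2 : ℤ) ≠ 0 := two_ne_zero
  haveI := W.finite_galoisCohomology_one_torsion_restrictField_of_finite w.Completion h2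
  have hmul := W.natCard_torsionBy_mul_natCard_kummerLocalConditionAt w.Completion h2
  have hfin : Finite ((galoisCohomology (W.localGaloisModule w.Completion) 1)[(2 : ℤ)]) := by
    refine Nat.finite_of_card_ne_zero fun h0 ↦ ?_
    rw [h0, zero_mul] at hmul
    exact Nat.card_pos.ne' hmul.symm
  have htop := W.torsionBy_galoisCohomology_localGaloisModule_eq_top_infinitePlace w (dvd_refl (2 : ℤ))
  haveI := hfin
  exact Finite.of_surjective (fun x : (galoisCohomology (W.localGaloisModule w.Completion) 1)[(2 : ℤ)] ↦
    (x : galoisCohomology (W.localGaloisModule w.Completion) 1)) fun c ↦ ⟨⟨c, htop ▸ AddSubgroup.mem_top c⟩, rfl⟩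

/-- The same in the currency of the Greenberg facts: `discreteH1 (localSubgroup ⊤ K_w) (localPoints W K_w)` is finite.
[cite: GreenbergLNM1716, §4 pp. 105–106] -/
theorem finite_localSubgroup_top_infinitePlace :
    Finite (discreteH1 (localSubgroup (⊤ : Subgroup (absoluteGaloisGroup K)) w.Completion)
      (localPoints W w.Completion)) := by
  haveI := finite_localH1_infinitePlace W w
  obtain ⟨e, -⟩ := exists_addEquiv_localH1_localSubgroup_top W w.Completion
  exact Finite.of_equiv _ e.toEquiv

/-- **At an infinite place the `p^k`-torsion of `𝒫_E(K_w)` is uniformly bounded** (by `#H¹(K_w, E(K̄_w))`), in the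
currency of the Greenberg facts. [cite: GreenbergLNM1716, §4 pp. 105–106] -/
theorem exists_natCard_torsionBy_localSubgroup_top_le_infinitePlace (p : ℕ) :
    ∃ B : ℕ, 0 < B ∧ ∀ k : ℕ,
      Finite ((discreteH1 (localSubgroup (⊤ : Subgroup (absoluteGaloisGroup K)) w.Completion)
        (localPoints W w.Completion))[((p ^ k : ℕ) : ℤ)]) ∧
      Nat.card ((discreteH1 (localSubgroup (⊤ : Subgroup (absoluteGaloisGroup K)) w.Completion)
        (localPoints W w.Completion))[((p ^ k : ℕ) : ℤ)]) ≤ B := by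
  haveI := finite_localSubgroup_top_infinitePlace W w
  refine ⟨Nat.card (discreteH1 (localSubgroup (⊤ : Subgroup (absoluteGaloisGroup K)) w.Completion)
      (localPoints W w.Completion)), Nat.card_pos, fun k ↦ ⟨inferInstance, ?_⟩⟩
  exact Nat.card_le_card_of_injective _ (AddSubgroup.subtype_injective _)

end Infinite

end Summit.BirchSwinnertonDyer.BirchSwinnertonDyer.Theorems.SignedEC.H1SigmaCorank

end
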